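import Mathlib
import HarnessLib
import Summits.HubbardSuperconductivity.HubbardSuperconductivity.Theorems.KLProgrammeKLRegimeFlowReadTransportFit
import Summits.HubbardSuperconductivity.HubbardSuperconductivity.Theorems.KLProgrammeKLRegimeFlowReadTransportSplit
import Summits.HubbardSuperconductivity.HubbardSuperconductivity.Theorems.KLProgrammeKLRegimeCountertermJacksonRemainderScaleLaw
import Summits.HubbardSuperconductivity.HubbardSuperconductivity.Theorems.KLProgrammeKLRegimeEngineFlowPieceTablesAllOrders
import Summits.HubbardSuperconductivity.HubbardSuperconductivity.Theorems.KLProgrammeKLRegimeEngineV8TwoLegSpaceMomentsExport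

/-!
# K3 gen-8-FLOW (stmt-HubbardSuperconductivity-20437 `KLRegimeEngineV17F2`, stub (C) `stub_twoLeg_curvature`, located risk #17 consumer side):
# «(C2)-ONE-CALL» — the (C2) TRANSPORT bracket of the private (P)-step at a GENERAL scale, and the (T) bracket at the LAST index, BY NAME from the
# engine history + ONE export (cell gate-hubbard-kl, seat p2 g23)

The (P)-step `KLRegimeSplit.twoLegReadPriv_flow_succ` (k3c3-p1) asks per scale `n` for the (C2) pair `(hTdiff, hT)` (rows `curveJetBar eT eT′ U k (n+1)`).
k3c3-p1's FITTED door `transport_jets_flow_fit` delivers it from the five nested sizes `M₁ … M₅` of the cumulative symbol `F = evalM ν̃_n` under the moment law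
`M_j ≤ m_j·U²·(4ⁿ)^{j−1}`, and `cumulativeSymbol_nested_sizes_of_split` reads `M_j := a_j + b_j` off the split `F = evalM K_n + evalM SI(S̃_n)`.  Here BOTH summands
are closed by name: (a) the FRAME jets `‖Dʲ evalM K_n‖`, `1 ≤ j ≤ 5`, closer-internal from the flow history `∀ m ≤ n′, FlowPieceJetsAt …` / `TwoLegReadJetsF …`
(orders `≤ 4`: `flowFrame_sizes_closed`; order `5`: p2 g13's `flowPiece_jets_allOrders` summed by `norm_iteratedFDeriv_evalM_klFlowFrameU_le_sum` — the
«(C2)-M5-FRAME» mechanism) in LAW-A form `a_j ≤ aF_j·U²·(4ⁿ)^{j−1}`, `aF = (4·Gfr₁/3, Gfr₂, Gfr₃/3, Gfr₄/15, 2⁵·(π⁸/4·2⁴·2³²)·W/63)`,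
`W = curveExtC X G.S 1 + curveExtC X Q.S′ 1·|U|` — **`flowFrame_jets_lawA`**; (b) the SEPARATED-symbol jets `b_j = 2·Z j` from the rev-14 #17 export
`TwoLegDualSpaceMomentsUpToAt L M (klZspLaw z U n) β U μ n 5` via `sep_jets_of_twoLegDualSpaceMomentsUpToAt` (the stub's string (ii) is `z := klZsp5 P R Q₀ G`).

* §2 **`transport_jets_flow_fit_of_spaceMoments`** — the LITERAL `(hTdiff, hT)` of the (P)-step at scale `n ≤ n_β` (`eT = 0`, ANY `eT′` above `transport_jets_flow_fit`'s
  table in `m` entrywise at `k ≤ 4`) from: regime, `FrameOK` at `K_n`/`K_{n+1}` (depth `n`), the history, the (P)-step's degree guard `4·klFlowDeg(n+1) ≤ L`, the export, five rows `aF_j + 2·z j ≤ m j`.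
* §3 **`transport_last_flow_fit_of_spaceMoments`** — the same device for the (T) bracket of `twoLegReadPriv_flow_succ_of_swap_lit` (k3c3-p1; `hTr/hTrdiff` of p2 g21's
  `twoLegRead_flow_last_registered_of_pos` at `n = n_β`): its symbol `SI(σ^{K_{n+1}}_{n+1}).eval + (klFlowPiece n).eval` EQUALS `evalM K_n + evalM SI(S̃_{n+1}[K_{n+1}])`
  (`K_{n+1} = K_n ⊖ p_n`), so k3c3-p3's generic door `transport_jets_of_frameOK_fun` at `(K₀, p, n) := (K_n, p_n, n)` + the export at index `n+1` (rows
  `aF_j + 2·4^{j−1}·z j ≤ m j`) + `transport_rows_fit` give the pair below any `eT′` dominating the same table.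

Compositions only (no definitions); export and history are hypotheses; nothing here asserts any stub of 20437, K3, the margin or superconductivity.
References: BGM 2006 §2.4 Lemma 2.1 (2.36)–(2.42), §2.3 (2.17) [cite: BenfattoGiulianiMastropietro2006]; FST 1996 §1 [cite: FeldmanSalmhoferTrubowitz1996].
-/

noncomputable section

namespace Summit.HubbardSuperconductivity.HubbardSuperconductivity.Theorems.EngineV8

set_option linter.dupNamespace false -- summit = problem name (single-conjunct summit), D-0017
set_option maxSynthPendingDepth 4 -- nested operator-norm instances (fifth Fréchet derivatives), as in the (C2) door

open Real Finset Literature.MathematicalPhysics.QuantumLattice Literature.Probability.LatticeModels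
open Literature.MathematicalPhysics.QuantumLattice.FermiRG
open Summit.HubbardSuperconductivity.HubbardSuperconductivity.Theorems.KLRegimeSplit
open Summit.HubbardSuperconductivity.HubbardSuperconductivity.Theorems.DispersionFlow
open Summit.HubbardSuperconductivity.HubbardSuperconductivity.Theorems.PerturbedFermiCurve

/-! ## §0 Arithmetic -/

/-- `63·Σ_{m<n} 64^m + 1 ≤ 64ⁿ`. -/
theorem sixtythree_mul_sum_range_sixtyfour_pow_le (n : ℕ) : 63 * ∑ m ∈ range n, (64 : ℝ) ^ m + 1 ≤ 64 ^ n := by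
  induction n with
  | zero => simp
  | succ n ih => rw [sum_range_succ, pow_succ]; linarith

/-- `n ≤ 4ⁿ` (real form). -/
theorem nat_cast_le_four_pow (n : ℕ) : (n : ℝ) ≤ (4 : ℝ) ^ n := by
  induction n with
  | zero => simp
  | succ n ih =>
    have h1 : (1 : ℝ) ≤ (4 : ℝ) ^ n := one_le_pow₀ (by norm_num)
    rw [pow_succ]; push_cast; linarith

/-- `4^{(5−2)·m} = 64^m` (the order-5 exponent of the geometric piece table). -/
theorem four_zpow_five_sub_two_mul (m : ℕ) : (4 : ℝ) ^ ((((5 : ℕ) : ℤ) - 2) * (m : ℕ)) = (64 : ℝ) ^ m := by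
  rw [show (((5 : ℕ) : ℤ) - 2) * ((m : ℕ) : ℤ) = ((3 * m : ℕ) : ℤ) by push_cast; ring, zpow_natCast, pow_mul]
  norm_num

variable {L M : ℕ} [NeZero L] [NeZero M]

/-! ## §1 The flow frame's jets to order five, in law-A form, from the history -/

/-- **Order five of ONE piece**: `‖D⁵ evalM (klFlowPiece m)‖ ≤ 2⁵·(π⁸/4·2⁴·2³²)·(W·U²)·64^m` — `flowPiece_jets_allOrders` at `j = 5`. -/
theorem flowPiece_jet_five_le {G : GeoConsts} {Q : EngConsts} {R : RenConsts} (hGS : ∀ k, 0 ≤ G.S k) (hQS : ∀ k, 0 ≤ Q.S' k)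
    {β U μ : ℝ} (hμ : μ ∈ klWindowC) {X : ℝ} (hX : ∀ l ≤ 4, ∀ x : ℝ, ‖iteratedFDeriv ℝ l salmhoferCutoff x‖ ≤ X)
    {n' : ℕ} (hP : ∀ m ≤ n', FlowPieceJetsAt L M β U μ R m) (hT : ∀ m ≤ n', TwoLegReadJetsF L M G Q β U μ m) {m : ℕ} (hm : m ≤ n')
    (q : Momentum) :
    ‖iteratedFDeriv ℝ 5 (evalM (klFlowPiece L M β U μ m)) q‖ ≤ 2 ^ 5 * (Real.pi ^ 8 / 4 * 2 ^ 4 * (2 : ℝ) ^ 32) * ((curveExtC X G.S 1 + curveExtC X Q.S' 1 * |U|) * U ^ 2) * (64 : ℝ) ^ m := by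
  have h := flowPiece_jets_allOrders hGS hQS hμ hX hP hT m hm 5 q
  rw [if_neg (by norm_num)] at h
  refine h.trans (le_of_eq ?_)
  rw [four_zpow_five_sub_two_mul m]

/-- **`flowFrame_jets_lawA` — the FRAME jets of `K_n` to order five in LAW-A form** (`j = 1 … 5`; orders `≤ 4` from `flowFrame_sizes_closed`, order `5` from the
all-orders piece table summed over the history; `n ≤ 4ⁿ`, `16ⁿ = (4ⁿ)²`, `63·Σ64^m < 64ⁿ ≤ (4ⁿ)⁴`). -/
theorem flowFrame_jets_lawA {G : GeoConsts} {Q : EngConsts} {R : RenConsts} (hR : ∀ j, 0 ≤ R.Gfr j) (hGS : ∀ k, 0 ≤ G.S k)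
    (hQS : ∀ k, 0 ≤ Q.S' k) {β U μ : ℝ} (hμ : μ ∈ klWindowC) {X : ℝ} (hX : ∀ l ≤ 4, ∀ x : ℝ, ‖iteratedFDeriv ℝ l salmhoferCutoff x‖ ≤ X)
    {n' : ℕ} (hP : ∀ m ≤ n', FlowPieceJetsAt L M β U μ R m) (hT : ∀ m ≤ n', TwoLegReadJetsF L M G Q β U μ m) {n : ℕ} (hn : n ≤ n' + 1) :
    ∀ j, 1 ≤ j → j ≤ 5 → ∀ q : Momentum, ‖iteratedFDeriv ℝ j (evalM (klFlowFrameU L M β U μ n)) q‖ ≤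
      (if j = 1 then 4 / 3 * R.Gfr 1 * U ^ 2 * ((4 : ℝ) ^ n) ^ 0 else if j = 2 then R.Gfr 2 * U ^ 2 * ((4 : ℝ) ^ n) ^ 1 else if j = 3 then R.Gfr 3 / 3 * U ^ 2 * ((4 : ℝ) ^ n) ^ 2 else if j = 4 then R.Gfr 4 / 15 * U ^ 2 * ((4 : ℝ) ^ n) ^ 3 else 2 ^ 5 * (Real.pi ^ 8 / 4 * 2 ^ 4 * (2 : ℝ) ^ 32) * (curveExtC X G.S 1 + curveExtC X Q.S' 1 * |U|) / 63 * U ^ 2 * ((4 : ℝ) ^ n) ^ 4) := by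
  intro j hj1 hj5 q
  have hist : ∀ m < n, FlowPieceJetsAt L M β U μ R m := fun m hm => hP m (by omega)
  obtain ⟨-, h1, h2, h3, h4⟩ := flowFrame_sizes_closed hR hist q
  have hx : (1 : ℝ) ≤ (4 : ℝ) ^ n := one_le_pow₀ (by norm_num)
  have hx0 : (0 : ℝ) ≤ (4 : ℝ) ^ n := by positivity
  have hU2 : 0 ≤ U ^ 2 := sq_nonneg U
  have hG2 := hR 2; have hG3 := hR 3; have hG4 := hR 4
  rcases (show j = 1 ∨ j = 2 ∨ j = 3 ∨ j = 4 ∨ j = 5 by omega) with rfl | rfl | rfl | rfl | rfl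
  · rw [if_pos rfl, pow_zero, mul_one]
    exact h1
  · rw [if_neg (by norm_num), if_pos rfl, pow_one]
    have hn4 : (n : ℝ) ≤ (4 : ℝ) ^ n := nat_cast_le_four_pow n
    calc _ ≤ (n : ℝ) * R.Gfr 2 * U ^ 2 := h2
      _ ≤ (4 : ℝ) ^ n * R.Gfr 2 * U ^ 2 := by gcongr
      _ = R.Gfr 2 * U ^ 2 * (4 : ℝ) ^ n := by ring
  · rw [if_neg (by norm_num), if_neg (by norm_num), if_pos rfl]
    have h12 : (4 : ℝ) ^ n ≤ ((4 : ℝ) ^ n) ^ 2 := by nlinarith [hx]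
    calc _ ≤ R.Gfr 3 / 3 * U ^ 2 * (4 : ℝ) ^ n := h3
      _ ≤ R.Gfr 3 / 3 * U ^ 2 * ((4 : ℝ) ^ n) ^ 2 := mul_le_mul_of_nonneg_left h12 (by positivity)
  · rw [if_neg (by norm_num), if_neg (by norm_num), if_neg (by norm_num), if_pos rfl]
    have h23 : ((4 : ℝ) ^ n) ^ 2 ≤ ((4 : ℝ) ^ n) ^ 3 := pow_le_pow_right₀ hx (by norm_num)
    calc _ ≤ R.Gfr 4 / 15 * U ^ 2 * (16 : ℝ) ^ n := h4
      _ = R.Gfr 4 / 15 * U ^ 2 * ((4 : ℝ) ^ n) ^ 2 := by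
          rw [show (16 : ℝ) ^ n = ((4 : ℝ) ^ n) ^ 2 by rw [show (16 : ℝ) = 4 ^ 2 by norm_num, ← pow_mul, pow_mul']]
      _ ≤ R.Gfr 4 / 15 * U ^ 2 * ((4 : ℝ) ^ n) ^ 3 := mul_le_mul_of_nonneg_left h23 (by positivity)
  · rw [if_neg (by norm_num), if_neg (by norm_num), if_neg (by norm_num), if_neg (by norm_num)]
    have hX0 : 0 ≤ X := (norm_nonneg _).trans (hX 0 (by norm_num) 0)
    have hW : 0 ≤ (curveExtC X G.S 1 + curveExtC X Q.S' 1 * |U|) := by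
      have hc1 := curveExtC_nonneg hX0 hGS 1
      have hc2 := curveExtC_nonneg hX0 hQS 1
      positivity
    have h5 := norm_iteratedFDeriv_evalM_klFlowFrameU_le_sum (L := L) (M := M) (β := β) (U := U) (μ := μ) (n := n) (j := 5)
      (pj := fun m' _ => 2 ^ 5 * (Real.pi ^ 8 / 4 * 2 ^ 4 * (2 : ℝ) ^ 32) * ((curveExtC X G.S 1 + curveExtC X Q.S' 1 * |U|) * U ^ 2) * (64 : ℝ) ^ m')
      (fun m' hm' q' => flowPiece_jet_five_le hGS hQS hμ hX hP hT (by omega) q') q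
    refine h5.trans ?_
    show ∑ m' ∈ range n, 2 ^ 5 * (Real.pi ^ 8 / 4 * 2 ^ 4 * (2 : ℝ) ^ 32) * ((curveExtC X G.S 1 + curveExtC X Q.S' 1 * |U|) * U ^ 2) * (64 : ℝ) ^ m' ≤ _
    rw [← mul_sum]
    have hs := sixtythree_mul_sum_range_sixtyfour_pow_le n
    have e64 : (64 : ℝ) ^ n = ((4 : ℝ) ^ n) ^ 3 := by rw [show (64 : ℝ) = 4 ^ 3 by norm_num, ← pow_mul, pow_mul']
    have h34 : ((4 : ℝ) ^ n) ^ 3 ≤ ((4 : ℝ) ^ n) ^ 4 := pow_le_pow_right₀ hx (by norm_num)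
    have hle : ∑ m' ∈ range n, (64 : ℝ) ^ m' ≤ ((4 : ℝ) ^ n) ^ 4 / 63 := by
      rw [le_div_iff₀ (by norm_num : (0 : ℝ) < 63)]
      linarith
    have hC : 0 ≤ 2 ^ 5 * (Real.pi ^ 8 / 4 * 2 ^ 4 * (2 : ℝ) ^ 32) * ((curveExtC X G.S 1 + curveExtC X Q.S' 1 * |U|) * U ^ 2) := mul_nonneg (by positivity) (mul_nonneg hW hU2)
    calc 2 ^ 5 * (Real.pi ^ 8 / 4 * 2 ^ 4 * (2 : ℝ) ^ 32) * ((curveExtC X G.S 1 + curveExtC X Q.S' 1 * |U|) * U ^ 2) * ∑ m' ∈ range n, (64 : ℝ) ^ m'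
        ≤ 2 ^ 5 * (Real.pi ^ 8 / 4 * 2 ^ 4 * (2 : ℝ) ^ 32) * ((curveExtC X G.S 1 + curveExtC X Q.S' 1 * |U|) * U ^ 2) * (((4 : ℝ) ^ n) ^ 4 / 63) := mul_le_mul_of_nonneg_left hle hC
      _ = 2 ^ 5 * (Real.pi ^ 8 / 4 * 2 ^ 4 * (2 : ℝ) ^ 32) * (curveExtC X G.S 1 + curveExtC X Q.S' 1 * |U|) / 63 * U ^ 2 * ((4 : ℝ) ^ n) ^ 4 := by ring

/-! ## §1b Bookkeeping: jets of a sum of two `evalM`s, and nested `fderiv` norms from `iteratedFDeriv` jets -/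

omit [NeZero L] [NeZero M] in
/-- `‖Dʲ(evalM K + evalM S)‖ ≤ a j + b j` from the two tables (`1 ≤ j ≤ 5`). -/
theorem jets_evalM_add_evalM {K S : TrigPolyC4v} {a b : ℕ → ℝ}
    (ha : ∀ j, 1 ≤ j → j ≤ 5 → ∀ q : Momentum, ‖iteratedFDeriv ℝ j (evalM K) q‖ ≤ a j)
    (hb : ∀ j, 1 ≤ j → j ≤ 5 → ∀ q : Momentum, ‖iteratedFDeriv ℝ j (evalM S) q‖ ≤ b j) :
    ∀ j, 1 ≤ j → j ≤ 5 → ∀ q : Momentum, ‖iteratedFDeriv ℝ j (fun q : Momentum => evalM K q + evalM S q) q‖ ≤ a j + b j := by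
  intro j hj1 hj5 q
  rw [show (fun q : Momentum => evalM K q + evalM S q) = evalM K + evalM S from rfl,
    iteratedFDeriv_add_apply (contDiff_evalM K (k := (j : ℕ∞))).contDiffAt ((contDiff_evalM S (k := (j : ℕ∞))).contDiffAt (x := q))]
  exact (norm_add_le _ _).trans (add_le_add (ha j hj1 hj5 q) (hb j hj1 hj5 q))

/-- Monotonicity of `curveJetBar (fun _ => 0) · U k n` in the primed table AT the order `k`. -/
theorem curveJetBar_zero_mono_snd_at {T T' : ℕ → ℝ} {U : ℝ} {k n : ℕ} (h : T k ≤ T' k) :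
    curveJetBar (fun _ => 0) T U k n ≤ curveJetBar (fun _ => 0) T' U k n := by
  rw [curveJetBar_apply, curveJetBar_apply]
  exact mul_le_mul_of_nonneg_right (mul_le_mul_of_nonneg_right
    (add_le_add le_rfl (mul_le_mul_of_nonneg_right h (abs_nonneg U))) (uPow_nonneg k U)) (zpow_nonneg (by norm_num) _)

omit [NeZero L] [NeZero M] in
/-- The five NESTED `fderiv` sizes of a function from its `iteratedFDeriv` jets `1 … 5`. -/
theorem nested_five_of_jets {F : Momentum → ℝ} {A : ℕ → ℝ} (h : ∀ j, 1 ≤ j → j ≤ 5 → ∀ q : Momentum, ‖iteratedFDeriv ℝ j F q‖ ≤ A j) :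
    (∀ w, ‖fderiv ℝ F w‖ ≤ A 1) ∧ (∀ w, ‖fderiv ℝ (fderiv ℝ F) w‖ ≤ A 2) ∧ (∀ w, ‖fderiv ℝ (fderiv ℝ (fderiv ℝ F)) w‖ ≤ A 3) ∧
      (∀ w, ‖fderiv ℝ (fderiv ℝ (fderiv ℝ (fderiv ℝ F))) w‖ ≤ A 4) ∧
      (∀ w, ‖fderiv ℝ (fderiv ℝ (fderiv ℝ (fderiv ℝ (fderiv ℝ F)))) w‖ ≤ A 5) := by
  refine ⟨fun w => ?_, fun w => ?_, fun w => ?_, fun w => ?_, fun w => ?_⟩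
  · rw [norm_fderiv_eq_norm_iteratedFDeriv_one]; exact h 1 le_rfl (by norm_num) w
  · rw [norm_fderiv_two_eq_norm_iteratedFDeriv]; exact h 2 (by norm_num) (by norm_num) w
  · rw [norm_fderiv_three_eq_norm_iteratedFDeriv]; exact h 3 (by norm_num) (by norm_num) w
  · rw [norm_fderiv_four_eq_norm_iteratedFDeriv]; exact h 4 (by norm_num) (by norm_num) w
  · rw [norm_fderiv_five_eq_norm_iteratedFDeriv]; exact h 5 (by norm_num) (by norm_num) w

/-! ## §2 The general step: the (C2) pair of `twoLegReadPriv_flow_succ` at scale `n`, one call -/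

section General

variable {G : GeoConsts} {Q : EngConsts} {R : RenConsts} (hR : ∀ j, 0 ≤ R.Gfr j) (hGS : ∀ k, 0 ≤ G.S k) (hQS : ∀ k, 0 ≤ Q.S' k)
  {c U β μ : ℝ} (hc : 0 < c) (hcle : c ≤ klCurveC3 R) (hU : 0 < U) (hUle : U ≤ klCurveU0 R)
  (hβmin : klBetaMin ≤ β) (hβc : β ≤ Real.exp (c / U ^ 2)) (hμ : μ ∈ klWindowC) {n : ℕ} (hn : n ≤ nScales β)
  (hK₀ : FrameOK R U n μ (klFlowFrameU L M β U μ n)) (hK : FrameOK R U n μ (klFlowFrameU L M β U μ (n + 1)))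
  {X : ℝ} (hX : ∀ l ≤ 4, ∀ x : ℝ, ‖iteratedFDeriv ℝ l salmhoferCutoff x‖ ≤ X)
  {n' : ℕ} (hP : ∀ m ≤ n', FlowPieceJetsAt L M β U μ R m) (hT : ∀ m ≤ n', TwoLegReadJetsF L M G Q β U μ m) (hnn' : n ≤ n')
  (hLdeg : 4 * klFlowDeg (n + 1) ≤ L)
  {z : ℕ → ℝ} {m : ℕ → ℝ} (hm : ∀ j, 0 ≤ m j)

section AtN

variable (hZ : TwoLegDualSpaceMomentsUpToAt L M (klZspLaw z U n) β U μ n 5)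
  (hm1 : 4 / 3 * R.Gfr 1 + 2 * z 1 ≤ m 1) (hm2 : R.Gfr 2 + 2 * z 2 ≤ m 2) (hm3 : R.Gfr 3 / 3 + 2 * z 3 ≤ m 3)
  (hm4 : R.Gfr 4 / 15 + 2 * z 4 ≤ m 4) (hm5 : 2 ^ 5 * (Real.pi ^ 8 / 4 * 2 ^ 4 * (2 : ℝ) ^ 32) * (curveExtC X G.S 1 + curveExtC X Q.S' 1 * |U|) / 63 + 2 * z 5 ≤ m 5)
  {eT' : ℕ → ℝ} (heT : ∀ k ≤ 4,
        (fun k : ℕ =>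
          if k = 0 then 16 * ((12.2 * R.Gfr 0 * m 1))
          else if k = 1 then 4 * ((1420 * 2 * (R.Gfr 1 + R.Gfr 2 + R.Gfr 3 + R.Gfr 4) * (1 + 2 * (R.Gfr 3 + R.Gfr 4)) * m 1) + (36400 * R.Gfr 0 * m 1) + (2820 * R.Gfr 0 * m 2))
          else if k = 2 then ((12900000 * 2 ^ 2 * (R.Gfr 1 + R.Gfr 2 + R.Gfr 3 + R.Gfr 4) * (1 + 2 * (R.Gfr 3 + R.Gfr 4)) ^ 2 * m 1) + (657000 * 2 * (R.Gfr 1 + R.Gfr 2 + R.Gfr 3 + R.Gfr 4) * (1 + 2 * (R.Gfr 3 + R.Gfr 4)) * m 2) + (338000000 * 2 * R.Gfr 0 * (1 + 2 * (R.Gfr 3 + R.Gfr 4)) * m 1) + (25400000 * R.Gfr 0 * m 2) + (652000 * R.Gfr 0 * m 3))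
          else if k = 3 then ((199000000000 * 2 ^ 3 * (R.Gfr 1 + R.Gfr 2 + R.Gfr 3 + R.Gfr 4) * (1 + 2 * (R.Gfr 3 + R.Gfr 4)) ^ 3 * m 1) + (12000000000 * 2 ^ 2 * (R.Gfr 1 + R.Gfr 2 + R.Gfr 3 + R.Gfr 4) * (1 + 2 * (R.Gfr 3 + R.Gfr 4)) ^ 2 * m 2) + (228000000 * 2 * (R.Gfr 1 + R.Gfr 2 + R.Gfr 3 + R.Gfr 4) * (1 + 2 * (R.Gfr 3 + R.Gfr 4)) * m 3) + (5230000000000 * 2 ^ 2 * R.Gfr 0 * (1 + 2 * (R.Gfr 3 + R.Gfr 4)) ^ 2 * m 1) + (392000000000 * 2 * R.Gfr 0 * (1 + 2 * (R.Gfr 3 + R.Gfr 4)) * m 2) + (11800000000 * R.Gfr 0 * m 3) + (151000000 * R.Gfr 0 * m 4)) / 4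
          else if k = 4 then ((4300000000000000 * 2 ^ 4 * (R.Gfr 1 + R.Gfr 2 + R.Gfr 3 + R.Gfr 4) * (1 + 2 * (R.Gfr 3 + R.Gfr 4)) ^ 4 * m 1) + (276000000000000 * 2 ^ 3 * (R.Gfr 1 + R.Gfr 2 + R.Gfr 3 + R.Gfr 4) * (1 + 2 * (R.Gfr 3 + R.Gfr 4)) ^ 3 * m 2) + (6890000000000 * 2 ^ 2 * (R.Gfr 1 + R.Gfr 2 + R.Gfr 3 + R.Gfr 4) * (1 + 2 * (R.Gfr 3 + R.Gfr 4)) ^ 2 * m 3) + (70100000000 * 2 * (R.Gfr 1 + R.Gfr 2 + R.Gfr 3 + R.Gfr 4) * (1 + 2 * (R.Gfr 3 + R.Gfr 4)) * m 4) + (114000000000000000 * 2 ^ 2 * R.Gfr 0 * (1 + 2 * (R.Gfr 3 + R.Gfr 4)) ^ 2 * m 1) + (8490000000000000 * 2 ^ 2 * R.Gfr 0 * (1 + 2 * (R.Gfr 3 + R.Gfr 4)) ^ 2 * m 2) + (272000000000000 * 2 * R.Gfr 0 * (1 + 2 * (R.Gfr 3 + R.Gfr 4)) * m 3) + (4530000000000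 * R.Gfr 0 * m 4) + (34800000000 * R.Gfr 0 * m 5) + (69200000000 * (16 / 15) * R.Gfr 4 * m 1)) / 16
          else 0) k ≤ eT' k)
include hR hGS hQS hc hcle hU hUle hβmin hβc hμ hn hK₀ hK hX hP hT hnn' hLdeg hm hZ hm1 hm2 hm3 hm4 hm5 heT

/-- **«(C2)-ONE-CALL», GENERAL STEP — `transport_jets_flow_fit_of_spaceMoments`**: the LITERAL `(hTdiff, hT)` pair of `twoLegReadPriv_flow_succ` at scale `n`
(`eT = 0`; `eT′` = `transport_jets_flow_fit`'s table in `m`) from the regime, the two `FrameOK`s at depth `n`, the flow history, the (P)-step's degree guard, the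
#17 export at `(K_n, n)` and five n-free rows `aF_j + 2·z j ≤ m j`. [cite: BenfattoGiulianiMastropietro2006, §2.4 Lemma 2.1 (2.40)] -/
theorem transport_jets_flow_fit_of_spaceMoments :
    ContDiff ℝ 4 (fun θ : ℝ =>
      (symInterp L (klLocSelfEnergyRe L M β U μ (klFlowFrameU L M β U μ n) n)).eval (klFermiPoint μ (klFlowFrameU L M β U μ (n + 1)) θ) -
        klLocalPart L M β U μ (klFlowFrameU L M β U μ n) n θ) ∧
    ∀ k ≤ 4, ∀ θ : ℝ, |iteratedDeriv k (fun θ : ℝ =>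
      (symInterp L (klLocSelfEnergyRe L M β U μ (klFlowFrameU L M β U μ n) n)).eval (klFermiPoint μ (klFlowFrameU L M β U μ (n + 1)) θ) -
        klLocalPart L M β U μ (klFlowFrameU L M β U μ n) n θ) θ| ≤ curveJetBar (fun _ => 0) eT' U k (n + 1) := by
  obtain ⟨hdeg, -⟩ := degree_klFlowFrameU_le_half (L := L) (M := M) (β := β) (U := U) (μ := μ) (n := n) hLdeg
  have hβ0 : 0 < β := KLRegimeSplit.pos_of_klBetaMin_le hβmin
  have ha := flowFrame_jets_lawA (L := L) (M := M) hR hGS hQS hμ hX hP hT (n := n) (by omega)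
  have hb := sep_jets_of_twoLegDualSpaceMomentsUpToAt hβ0 hZ
  obtain ⟨hM₁, hM₂, hM₃, hM₄, hM₅⟩ := cumulativeSymbol_nested_sizes_of_split (L := L) (M := M) β U μ hdeg n
    (a := fun j => (if j = 1 then 4 / 3 * R.Gfr 1 * U ^ 2 * ((4 : ℝ) ^ n) ^ 0 else if j = 2 then R.Gfr 2 * U ^ 2 * ((4 : ℝ) ^ n) ^ 1 else if j = 3 then R.Gfr 3 / 3 * U ^ 2 * ((4 : ℝ) ^ n) ^ 2 else if j = 4 then R.Gfr 4 / 15 * U ^ 2 * ((4 : ℝ) ^ n) ^ 3 else 2 ^ 5 * (Real.pi ^ 8 / 4 * 2 ^ 4 * (2 : ℝ) ^ 32) * (curveExtC X G.S 1 + curveExtC X Q.S' 1 * |U|) / 63 * U ^ 2 * ((4 : ℝ) ^ n) ^ 4))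
    (b := fun j => 2 * klZspLaw z U n j) ha hb
  have hF := cumulativeSymbol_contDiff (L := L) (M := M) β U μ (klFlowFrameU L M β U μ n) n (k := 5)
  have hw : ∀ p : ℕ, 0 ≤ U ^ 2 * ((4 : ℝ) ^ n) ^ p := fun p => by positivity
  have hlaw1 : (if (1 : ℕ) = 1 then 4 / 3 * R.Gfr 1 * U ^ 2 * ((4 : ℝ) ^ n) ^ 0 else if (1 : ℕ) = 2 then R.Gfr 2 * U ^ 2 * ((4 : ℝ) ^ n) ^ 1 else if (1 : ℕ) = 3 then R.Gfr 3 / 3 * U ^ 2 * ((4 : ℝ) ^ n) ^ 2 else if (1 : ℕ) = 4 then R.Gfr 4 / 15 * U ^ 2 * ((4 : ℝ) ^ n) ^ 3 else 2 ^ 5 * (Real.pi ^ 8 / 4 * 2 ^ 4 * (2 : ℝ) ^ 32) * (curveExtC X G.S 1 + curveExtC X Q.S' 1 * |U|) / 63 * U ^ 2 * ((4 : ℝ) ^ n) ^ 4) + 2 * klZspLaw z U n 1 ≤ m 1 * U ^ 2 * ((4 : ℝ) ^ n) ^ 0 := by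
    rw [if_pos rfl, two_mul_klZspLaw, show (1 : ℕ) - 1 = 0 from rfl]
    calc _ = (4 / 3 * R.Gfr 1 + 2 * z 1) * (U ^ 2 * ((4 : ℝ) ^ n) ^ 0) := by ring
      _ ≤ m 1 * (U ^ 2 * ((4 : ℝ) ^ n) ^ 0) := mul_le_mul_of_nonneg_right hm1 (hw 0)
      _ = m 1 * U ^ 2 * ((4 : ℝ) ^ n) ^ 0 := by ring
  have hlaw2 : (if (2 : ℕ) = 1 then 4 / 3 * R.Gfr 1 * U ^ 2 * ((4 : ℝ) ^ n) ^ 0 else if (2 : ℕ) = 2 then R.Gfr 2 * U ^ 2 * ((4 : ℝ) ^ n) ^ 1 else if (2 : ℕ) = 3 then R.Gfr 3 / 3 * U ^ 2 * ((4 : ℝ) ^ n) ^ 2 else if (2 : ℕ) = 4 then R.Gfr 4 / 15 * U ^ 2 * ((4 : ℝ) ^ n) ^ 3 else 2 ^ 5 * (Real.pi ^ 8 / 4 * 2 ^ 4 * (2 : ℝ) ^ 32) * (curveExtC X G.S 1 + curveExtC X Q.S' 1 * |U|) / 63 * U ^ 2 * ((4 : ℝ) ^ n) ^ 4) + 2 *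 klZspLaw z U n 2 ≤ m 2 * U ^ 2 * ((4 : ℝ) ^ n) ^ 1 := by
    rw [if_neg (by norm_num), if_pos rfl, two_mul_klZspLaw, show (2 : ℕ) - 1 = 1 from rfl]
    calc _ = (R.Gfr 2 + 2 * z 2) * (U ^ 2 * ((4 : ℝ) ^ n) ^ 1) := by ring
      _ ≤ m 2 * (U ^ 2 * ((4 : ℝ) ^ n) ^ 1) := mul_le_mul_of_nonneg_right hm2 (hw 1)
      _ = m 2 * U ^ 2 * ((4 : ℝ) ^ n) ^ 1 := by ring
  have hlaw3 : (if (3 : ℕ) = 1 then 4 / 3 * R.Gfr 1 * U ^ 2 * ((4 : ℝ) ^ n) ^ 0 else if (3 : ℕ) = 2 then R.Gfr 2 * U ^ 2 * ((4 : ℝ) ^ n) ^ 1 else if (3 : ℕ) = 3 then R.Gfr 3 / 3 * U ^ 2 * ((4 : ℝ) ^ n) ^ 2 else if (3 : ℕ) = 4 then R.Gfr 4 / 15 * U ^ 2 * ((4 : ℝ) ^ n) ^ 3 else 2 ^ 5 * (Real.pi ^ 8 / 4 * 2 ^ 4 * (2 : ℝ) ^ 32) * (curveExtC X G.S 1 +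 curveExtC X Q.S' 1 * |U|) / 63 * U ^ 2 * ((4 : ℝ) ^ n) ^ 4) + 2 * klZspLaw z U n 3 ≤ m 3 * U ^ 2 * ((4 : ℝ) ^ n) ^ 2 := by
    rw [if_neg (by norm_num), if_neg (by norm_num), if_pos rfl, two_mul_klZspLaw, show (3 : ℕ) - 1 = 2 from rfl]
    calc _ = (R.Gfr 3 / 3 + 2 * z 3) * (U ^ 2 * ((4 : ℝ) ^ n) ^ 2) := by ring
      _ ≤ m 3 * (U ^ 2 * ((4 : ℝ) ^ n) ^ 2) := mul_le_mul_of_nonneg_right hm3 (hw 2)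
      _ = m 3 * U ^ 2 * ((4 : ℝ) ^ n) ^ 2 := by ring
  have hlaw4 : (if (4 : ℕ) = 1 then 4 / 3 * R.Gfr 1 * U ^ 2 * ((4 : ℝ) ^ n) ^ 0 else if (4 : ℕ) = 2 then R.Gfr 2 * U ^ 2 * ((4 : ℝ) ^ n) ^ 1 else if (4 : ℕ) = 3 then R.Gfr 3 / 3 * U ^ 2 * ((4 : ℝ) ^ n) ^ 2 else if (4 : ℕ) = 4 then R.Gfr 4 / 15 * U ^ 2 * ((4 : ℝ) ^ n) ^ 3 else 2 ^ 5 * (Real.pi ^ 8 / 4 * 2 ^ 4 * (2 : ℝ) ^ 32) * (curveExtC X G.S 1 + curveExtC X Q.S' 1 * |U|) / 63 * U ^ 2 * ((4 : ℝ) ^ n) ^ 4) + 2 * klZspLaw z U n 4 ≤ m 4 * U ^ 2 * ((4 : ℝ) ^ n) ^ 3 := by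
    rw [if_neg (by norm_num), if_neg (by norm_num), if_neg (by norm_num), if_pos rfl, two_mul_klZspLaw, show (4 : ℕ) - 1 = 3 from rfl]
    calc _ = (R.Gfr 4 / 15 + 2 * z 4) * (U ^ 2 * ((4 : ℝ) ^ n) ^ 3) := by ring
      _ ≤ m 4 * (U ^ 2 * ((4 : ℝ) ^ n) ^ 3) := mul_le_mul_of_nonneg_right hm4 (hw 3)
      _ = m 4 * U ^ 2 * ((4 : ℝ) ^ n) ^ 3 := by ring
  have hlaw5 : (if (5 : ℕ) = 1 then 4 / 3 * R.Gfr 1 * U ^ 2 * ((4 : ℝ) ^ n) ^ 0 else if (5 : ℕ) = 2 then R.Gfr 2 * U ^ 2 * ((4 : ℝ) ^ n) ^ 1 else if (5 : ℕ) = 3 then R.Gfr 3 / 3 * U ^ 2 * ((4 : ℝ) ^ n) ^ 2 else if (5 : ℕ) = 4 then R.Gfr 4 / 15 * U ^ 2 * ((4 : ℝ) ^ n) ^ 3 else 2 ^ 5 * (Real.pi ^ 8 / 4 * 2 ^ 4 * (2 : ℝ) ^ 32) * (curveExtC X G.S 1 + curveExtC X Q.S' 1 * |U|) / 63 * U ^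 2 * ((4 : ℝ) ^ n) ^ 4) + 2 * klZspLaw z U n 5 ≤ m 5 * U ^ 2 * ((4 : ℝ) ^ n) ^ 4 := by
    rw [if_neg (by norm_num), if_neg (by norm_num), if_neg (by norm_num), if_neg (by norm_num), two_mul_klZspLaw, show (5 : ℕ) - 1 = 4 from rfl]
    calc _ = (2 ^ 5 * (Real.pi ^ 8 / 4 * 2 ^ 4 * (2 : ℝ) ^ 32) * (curveExtC X G.S 1 + curveExtC X Q.S' 1 * |U|) / 63 + 2 * z 5) * (U ^ 2 * ((4 : ℝ) ^ n) ^ 4) := by ring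
      _ ≤ m 5 * (U ^ 2 * ((4 : ℝ) ^ n) ^ 4) := mul_le_mul_of_nonneg_right hm5 (hw 4)
      _ = m 5 * U ^ 2 * ((4 : ℝ) ^ n) ^ 4 := by ring
  obtain ⟨hd, hr⟩ := transport_jets_flow_fit hR hc hcle hU hUle hβmin hβc hμ hn hK₀ hK (hP n hnn') hF hM₁ hM₂ hM₃ hM₄ hM₅ hm hlaw1 hlaw2 hlaw3
    hlaw4 hlaw5
  exact ⟨hd, fun k hk θ => (hr k hk θ).trans (curveJetBar_zero_mono_snd_at (heT k hk))⟩

end AtN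

section AtSucc

variable (hz : ∀ j, 0 ≤ z j) (hZ' : TwoLegDualSpaceMomentsUpToAt L M (klZspLaw z U (n + 1)) β U μ (n + 1) 5)
  (hl1 : 4 / 3 * R.Gfr 1 + 2 * z 1 ≤ m 1) (hl2 : R.Gfr 2 + 8 * z 2 ≤ m 2) (hl3 : R.Gfr 3 / 3 + 32 * z 3 ≤ m 3)
  (hl4 : R.Gfr 4 / 15 + 128 * z 4 ≤ m 4) (hl5 : 2 ^ 5 * (Real.pi ^ 8 / 4 * 2 ^ 4 * (2 : ℝ) ^ 32) * (curveExtC X G.S 1 + curveExtC X Q.S' 1 * |U|) / 63 + 512 * z 5 ≤ m 5)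
  {eT' : ℕ → ℝ} (heT : ∀ k ≤ 4,
        (fun k : ℕ =>
          if k = 0 then 16 * ((12.2 * R.Gfr 0 * m 1))
          else if k = 1 then 4 * ((1420 * 2 * (R.Gfr 1 + R.Gfr 2 + R.Gfr 3 + R.Gfr 4) * (1 + 2 * (R.Gfr 3 + R.Gfr 4)) * m 1) + (36400 * R.Gfr 0 * m 1) + (2820 * R.Gfr 0 * m 2))
          else if k = 2 then ((12900000 * 2 ^ 2 * (R.Gfr 1 + R.Gfr 2 + R.Gfr 3 + R.Gfr 4) * (1 + 2 * (R.Gfr 3 + R.Gfr 4)) ^ 2 * m 1) + (657000 * 2 * (R.Gfr 1 + R.Gfr 2 + R.Gfr 3 + R.Gfr 4) * (1 + 2 * (R.Gfr 3 + R.Gfr 4)) * m 2) + (338000000 * 2 * R.Gfr 0 * (1 + 2 * (R.Gfr 3 + R.Gfr 4)) * m 1) + (25400000 * R.Gfr 0 * m 2) + (652000 * R.Gfr 0 * m 3))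
          else if k = 3 then ((199000000000 * 2 ^ 3 * (R.Gfr 1 + R.Gfr 2 + R.Gfr 3 + R.Gfr 4) * (1 + 2 * (R.Gfr 3 + R.Gfr 4)) ^ 3 * m 1) + (12000000000 * 2 ^ 2 * (R.Gfr 1 + R.Gfr 2 + R.Gfr 3 + R.Gfr 4) * (1 + 2 * (R.Gfr 3 + R.Gfr 4)) ^ 2 * m 2) + (228000000 * 2 * (R.Gfr 1 + R.Gfr 2 + R.Gfr 3 + R.Gfr 4) * (1 + 2 * (R.Gfr 3 + R.Gfr 4)) * m 3) + (5230000000000 * 2 ^ 2 * R.Gfr 0 * (1 + 2 * (R.Gfr 3 + R.Gfr 4)) ^ 2 * m 1) + (392000000000 * 2 * R.Gfr 0 * (1 + 2 * (R.Gfr 3 + R.Gfr 4)) * m 2) + (11800000000 * R.Gfr 0 * m 3) + (151000000 * R.Gfr 0 * m 4)) / 4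
          else if k = 4 then ((4300000000000000 * 2 ^ 4 * (R.Gfr 1 + R.Gfr 2 + R.Gfr 3 + R.Gfr 4) * (1 + 2 * (R.Gfr 3 + R.Gfr 4)) ^ 4 * m 1) + (276000000000000 * 2 ^ 3 * (R.Gfr 1 + R.Gfr 2 + R.Gfr 3 + R.Gfr 4) * (1 + 2 * (R.Gfr 3 + R.Gfr 4)) ^ 3 * m 2) + (6890000000000 * 2 ^ 2 * (R.Gfr 1 + R.Gfr 2 + R.Gfr 3 + R.Gfr 4) * (1 + 2 * (R.Gfr 3 + R.Gfr 4)) ^ 2 * m 3) + (70100000000 * 2 * (R.Gfr 1 + R.Gfr 2 + R.Gfr 3 + R.Gfr 4) * (1 + 2 * (R.Gfr 3 + R.Gfr 4)) * m 4) + (114000000000000000 * 2 ^ 2 * R.Gfr 0 * (1 + 2 * (R.Gfr 3 + R.Gfr 4)) ^ 2 * m 1) + (8490000000000000 * 2 ^ 2 * R.Gfr 0 * (1 + 2 * (R.Gfr 3 + R.Gfr 4)) ^ 2 * m 2) + (272000000000000 * 2 * R.Gfr 0 * (1 + 2 * (R.Gfr 3 + R.Gfr 4)) * m 3) + (4530000000000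 * R.Gfr 0 * m 4) + (34800000000 * R.Gfr 0 * m 5) + (69200000000 * (16 / 15) * R.Gfr 4 * m 1)) / 16
          else 0) k ≤ eT' k)
include hR hGS hQS hc hcle hU hUle hβmin hβc hμ hn hK₀ hK hX hP hT hnn' hLdeg hz hm hZ' hl1 hl2 hl3 hl4 hl5 heT

/-! ## §3 The last index: the (T) bracket of `twoLegReadPriv_flow_succ_of_swap_lit`, one call -/

/-- **«(C2)-ONE-CALL», LAST INDEX — `transport_last_flow_fit_of_spaceMoments`**: the LITERAL `(hTdiff, hT)` pair of `twoLegReadPriv_flow_succ_of_swap_lit`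
(= `hTrdiff/hTr` of `twoLegRead_flow_last_registered_of_pos` at `n = n_β`) with `eT = 0` and the SAME `eT′` table in `m`: the symbol
`SI(σ^{K_{n+1}}_{n+1}).eval + (klFlowPiece n).eval = evalM K_n + evalM SI(S̃_{n+1}[K_{n+1}])` is transported between the Fermi points of `K_{n+1} = K_n ⊖ p_n` and `K_n`
by `transport_jets_of_frameOK_fun`; sizes = frame jets of `K_n` (law A at base `4ⁿ`) + the #17 export at `(K_{n+1}, n+1)` (rows `aF_j + 2·4^{j−1}·z j ≤ m j`).
[cite: BenfattoGiulianiMastropietro2006, §2.4 Lemma 2.1 (2.40)] -/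
theorem transport_last_flow_fit_of_spaceMoments :
    ContDiff ℝ 4 (fun θ : ℝ =>
      ((symInterp L (klLocSelfEnergyRe L M β U μ (klFlowFrameU L M β U μ (n + 1)) (n + 1))).eval
            (klFermiPoint μ (klFlowFrameU L M β U μ (n + 1)) θ) +
          (klFlowPiece L M β U μ n).eval (klFermiPoint μ (klFlowFrameU L M β U μ (n + 1)) θ)) -
        ((symInterp L (klLocSelfEnergyRe L M β U μ (klFlowFrameU L M β U μ (n + 1)) (n + 1))).eval
            (klFermiPoint μ (klFlowFrameU L M β U μ n) θ) +
          (klFlowPiece L M β U μ n).eval (klFermiPoint μ (klFlowFrameU L M β U μ n) θ))) ∧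
    ∀ k ≤ 4, ∀ θ : ℝ, |iteratedDeriv k (fun θ : ℝ =>
      ((symInterp L (klLocSelfEnergyRe L M β U μ (klFlowFrameU L M β U μ (n + 1)) (n + 1))).eval
            (klFermiPoint μ (klFlowFrameU L M β U μ (n + 1)) θ) +
          (klFlowPiece L M β U μ n).eval (klFermiPoint μ (klFlowFrameU L M β U μ (n + 1)) θ)) -
        ((symInterp L (klLocSelfEnergyRe L M β U μ (klFlowFrameU L M β U μ (n + 1)) (n + 1))).eval
            (klFermiPoint μ (klFlowFrameU L M β U μ n) θ) +
          (klFlowPiece L M β U μ n).eval (klFermiPoint μ (klFlowFrameU L M β U μ n) θ))) θ| ≤ curveJetBar (fun _ => 0) eT' U k (n + 1) := by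
  obtain ⟨-, hdeg1⟩ := degree_klFlowFrameU_le_half (L := L) (M := M) (β := β) (U := U) (μ := μ) (n := n) hLdeg
  have hβ0 : 0 < β := KLRegimeSplit.pos_of_klBetaMin_le hβmin
  have hU1 : U ≤ 1 := hUle.trans (klCurveU0_le_one R)
  have hx : (1 : ℝ) ≤ (4 : ℝ) ^ n := one_le_pow₀ (by norm_num)
  -- (a) frame jets of `K_n`, (b) separated jets at `(K_{n+1}, n+1)` from the export
  have ha := flowFrame_jets_lawA (L := L) (M := M) hR hGS hQS hμ hX hP hT (n := n) (by omega)
  have hb := sep_jets_of_twoLegDualSpaceMomentsUpToAt hβ0 hZ'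
  -- the symbol equals `evalM K_n + evalM SI(S̃_{n+1})`
  have hFsplit : (fun q : Momentum => (symInterp L (klLocSelfEnergyRe L M β U μ (klFlowFrameU L M β U μ (n + 1)) (n + 1))).eval (WithLp.ofLp q) + (klFlowPiece L M β U μ n).eval (WithLp.ofLp q)) =
      fun q : Momentum => evalM (klFlowFrameU L M β U μ n) q + evalM (symInterp L (fun k => klLocSelfEnergyRe L M β U μ (klFlowFrameU L M β U μ (n + 1)) (n + 1) k - (klFlowFrameU L M β U μ (n + 1)).eval (latticeMomentum L k))) q := by
    have hs := cumulativeSymbol_eq_frame_add_sep (L := L) (M := M) β U μ hdeg1 (n + 1)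
    funext q
    have hq : (symInterp L (klLocSelfEnergyRe L M β U μ (klFlowFrameU L M β U μ (n + 1)) (n + 1))).eval (WithLp.ofLp q) =
        evalM (klFlowFrameU L M β U μ (n + 1)) q + evalM (symInterp L (fun k => klLocSelfEnergyRe L M β U μ (klFlowFrameU L M β U μ (n + 1)) (n + 1) k - (klFlowFrameU L M β U μ (n + 1)).eval (latticeMomentum L k))) q := congrFun hs q
    have hKq : evalM (klFlowFrameU L M β U μ (n + 1)) q + (klFlowPiece L M β U μ n).eval (WithLp.ofLp q) = evalM (klFlowFrameU L M β U μ n) q := by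
      rw [klFlowFrameU_succ]; simp only [evalM, eval_fsub]; ring
    show (symInterp L (klLocSelfEnergyRe L M β U μ (klFlowFrameU L M β U μ (n + 1)) (n + 1))).eval (WithLp.ofLp q) + (klFlowPiece L M β U μ n).eval (WithLp.ofLp q) =
      evalM (klFlowFrameU L M β U μ n) q + evalM (symInterp L (fun k => klLocSelfEnergyRe L M β U μ (klFlowFrameU L M β U μ (n + 1)) (n + 1) k - (klFlowFrameU L M β U μ (n + 1)).eval (latticeMomentum L k))) q
    rw [hq]
    linarith
  have hj : ∀ j, 1 ≤ j → j ≤ 5 → ∀ q : Momentum, ‖iteratedFDeriv ℝ j (fun q : Momentum => (symInterp L (klLocSelfEnergyRe L M β U μ (klFlowFrameU L M β U μ (n + 1)) (n + 1))).eval (WithLp.ofLp q) + (klFlowPiece L M β U μ n).eval (WithLp.ofLp q)) q‖ ≤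
      (if j = 1 then 4 / 3 * R.Gfr 1 * U ^ 2 * ((4 : ℝ) ^ n) ^ 0 else if j = 2 then R.Gfr 2 * U ^ 2 * ((4 : ℝ) ^ n) ^ 1 else if j = 3 then R.Gfr 3 / 3 * U ^ 2 * ((4 : ℝ) ^ n) ^ 2 else if j = 4 then R.Gfr 4 / 15 * U ^ 2 * ((4 : ℝ) ^ n) ^ 3 else 2 ^ 5 * (Real.pi ^ 8 / 4 * 2 ^ 4 * (2 : ℝ) ^ 32) * (curveExtC X G.S 1 + curveExtC X Q.S' 1 * |U|) / 63 * U ^ 2 * ((4 : ℝ) ^ n) ^ 4) + 2 * klZspLaw z U (n + 1) j := by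
    rw [hFsplit]
    exact jets_evalM_add_evalM (a := fun j => (if j = 1 then 4 / 3 * R.Gfr 1 * U ^ 2 * ((4 : ℝ) ^ n) ^ 0 else if j = 2 then R.Gfr 2 * U ^ 2 * ((4 : ℝ) ^ n) ^ 1 else if j = 3 then R.Gfr 3 / 3 * U ^ 2 * ((4 : ℝ) ^ n) ^ 2 else if j = 4 then R.Gfr 4 / 15 * U ^ 2 * ((4 : ℝ) ^ n) ^ 3 else 2 ^ 5 * (Real.pi ^ 8 / 4 * 2 ^ 4 * (2 : ℝ) ^ 32) * (curveExtC X G.S 1 + curveExtC X Q.S' 1 * |U|) / 63 * U ^ 2 * ((4 : ℝ) ^ n) ^ 4)) (b := fun j => 2 * klZspLaw z U (n + 1) j) ha hb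
  obtain ⟨hM₁, hM₂, hM₃, hM₄, hM₅⟩ := nested_five_of_jets hj
  have hF5 : ContDiff ℝ 5 (fun q : Momentum => (symInterp L (klLocSelfEnergyRe L M β U μ (klFlowFrameU L M β U μ (n + 1)) (n + 1))).eval (WithLp.ofLp q) + (klFlowPiece L M β U μ n).eval (WithLp.ofLp q)) :=
    (cumulativeSymbol_contDiff (L := L) (M := M) β U μ (klFlowFrameU L M β U μ (n + 1)) (n + 1) (k := 5)).add (contDiff_evalM (klFlowPiece L M β U μ n))
  -- the door at `(K₀, p, n) := (K_n, p_n, n)` with the canonical graded parameters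
  obtain ⟨hl1', hA3, hA4, hh0, hhη⟩ := flow_graded_params hR U n
  have hη_nn : 0 ≤ (R.Gfr 1 + R.Gfr 2 + R.Gfr 3 + R.Gfr 4) * U ^ 2 * ((4 : ℝ) ^ (2 * n))⁻¹ := by
    have := hR 1; have := hR 2; have := hR 3; have := hR 4; positivity
  have hη₀_nn : 0 ≤ R.Gfr 0 * |U| * ((4 : ℝ) ^ (2 * n))⁻¹ := by have := hR 0; positivity
  have hK' : FrameOK R U n μ (fsub (klFlowFrameU L M β U μ n) (klFlowPiece L M β U μ n)) := by
    rw [← klFlowFrameU_succ]; exact hK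
  obtain ⟨hdiff, hrows⟩ := transport_jets_of_frameOK_fun hR hc hcle hU hUle hβmin hβc hμ hn hK₀ hK' (hP n hnn') hη_nn hη₀_nn hl1' hA3 hA4 hh0 hhη
    hF5 hM₁ hM₂ hM₃ hM₄ hM₅
  have hfun : (fun θ : ℝ =>
      ((symInterp L (klLocSelfEnergyRe L M β U μ (klFlowFrameU L M β U μ (n + 1)) (n + 1))).eval
            (klFermiPoint μ (klFlowFrameU L M β U μ (n + 1)) θ) +
          (klFlowPiece L M β U μ n).eval (klFermiPoint μ (klFlowFrameU L M β U μ (n + 1)) θ)) -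
        ((symInterp L (klLocSelfEnergyRe L M β U μ (klFlowFrameU L M β U μ (n + 1)) (n + 1))).eval
            (klFermiPoint μ (klFlowFrameU L M β U μ n) θ) +
          (klFlowPiece L M β U μ n).eval (klFermiPoint μ (klFlowFrameU L M β U μ n) θ))) =
      fun θ : ℝ =>
        (fun q : Momentum => (symInterp L (klLocSelfEnergyRe L M β U μ (klFlowFrameU L M β U μ (n + 1)) (n + 1))).eval (WithLp.ofLp q) + (klFlowPiece L M β U μ n).eval (WithLp.ofLp q))
            (WithLp.toLp 2 (klFermiPoint μ (fsub (klFlowFrameU L M β U μ n) (klFlowPiece L M β U μ n)) θ)) -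
          (fun q : Momentum => (symInterp L (klLocSelfEnergyRe L M β U μ (klFlowFrameU L M β U μ (n + 1)) (n + 1))).eval (WithLp.ofLp q) + (klFlowPiece L M β U μ n).eval (WithLp.ofLp q))
            (WithLp.toLp 2 (klFermiPoint μ (klFlowFrameU L M β U μ n) θ)) := by
    funext θ
    simp only [klFlowFrameU_succ]
  rw [hfun]
  refine ⟨hdiff, fun k hk θ => ?_⟩
  obtain ⟨r0, r1, r2, r3, r4⟩ := hrows θ
  -- nonnegativity of the five sizes and the moment law at base `4ⁿ`
  have hX0 : 0 ≤ X := (norm_nonneg _).trans (hX 0 (by norm_num) 0)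
  have hW : 0 ≤ (curveExtC X G.S 1 + curveExtC X Q.S' 1 * |U|) := by
    have hc1 := curveExtC_nonneg hX0 hGS 1
    have hc2 := curveExtC_nonneg hX0 hQS 1
    positivity
  have hw : ∀ p : ℕ, 0 ≤ U ^ 2 * ((4 : ℝ) ^ n) ^ p := fun p => by positivity
  have hzl : ∀ j, 0 ≤ 2 * klZspLaw z U (n + 1) j := fun j => by
    have := klZspLaw_nonneg hz U (n + 1) j; linarith
  have hG1 := hR 1; have hG2 := hR 2; have hG3 := hR 3; have hG4 := hR 4
  have hM1' : 0 ≤ (if (1 : ℕ) = 1 then 4 / 3 * R.Gfr 1 * U ^ 2 * ((4 : ℝ) ^ n) ^ 0 else if (1 : ℕ) = 2 then R.Gfr 2 * U ^ 2 * ((4 : ℝ) ^ n) ^ 1 else if (1 : ℕ) = 3 then R.Gfr 3 / 3 * U ^ 2 * ((4 : ℝ) ^ n) ^ 2 else if (1 : ℕ) = 4 then R.Gfr 4 / 15 * U ^ 2 * ((4 : ℝ) ^ n) ^ 3 else 2 ^ 5 * (Real.pi ^ 8 / 4 * 2 ^ 4 * (2 : ℝ) ^ 32) * (curveExtC X G.S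 1 + curveExtC X Q.S' 1 * |U|) / 63 * U ^ 2 * ((4 : ℝ) ^ n) ^ 4) + 2 * klZspLaw z U (n + 1) 1 := by
    rw [if_pos rfl]; exact add_nonneg (by positivity) (hzl 1)
  have hM2' : 0 ≤ (if (2 : ℕ) = 1 then 4 / 3 * R.Gfr 1 * U ^ 2 * ((4 : ℝ) ^ n) ^ 0 else if (2 : ℕ) = 2 then R.Gfr 2 * U ^ 2 * ((4 : ℝ) ^ n) ^ 1 else if (2 : ℕ) = 3 then R.Gfr 3 / 3 * U ^ 2 * ((4 : ℝ) ^ n) ^ 2 else if (2 : ℕ) = 4 then R.Gfr 4 / 15 * U ^ 2 * ((4 : ℝ) ^ n) ^ 3 else 2 ^ 5 * (Real.pi ^ 8 / 4 * 2 ^ 4 * (2 : ℝ) ^ 32) * (curveExtC X G.S 1 + curveExtC X Q.S' 1 * |U|) / 63 * U ^ 2 * ((4 : ℝ) ^ n) ^ 4) + 2 * klZspLaw z U (n + 1) 2 := by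
    rw [if_neg (by norm_num), if_pos rfl]; exact add_nonneg (by positivity) (hzl 2)
  have hM3' : 0 ≤ (if (3 : ℕ) = 1 then 4 / 3 * R.Gfr 1 * U ^ 2 * ((4 : ℝ) ^ n) ^ 0 else if (3 : ℕ) = 2 then R.Gfr 2 * U ^ 2 * ((4 : ℝ) ^ n) ^ 1 else if (3 : ℕ) = 3 then R.Gfr 3 / 3 * U ^ 2 * ((4 : ℝ) ^ n) ^ 2 else if (3 : ℕ) = 4 then R.Gfr 4 / 15 * U ^ 2 * ((4 : ℝ) ^ n) ^ 3 else 2 ^ 5 * (Real.pi ^ 8 / 4 * 2 ^ 4 * (2 : ℝ) ^ 32) * (curveExtC X G.S 1 + curveExtC X Q.S' 1 * |U|) / 63 * U ^ 2 * ((4 : ℝ) ^ n) ^ 4) + 2 * klZspLaw z U (n + 1) 3 := by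
    rw [if_neg (by norm_num), if_neg (by norm_num), if_pos rfl]; exact add_nonneg (by positivity) (hzl 3)
  have hM4' : 0 ≤ (if (4 : ℕ) = 1 then 4 / 3 * R.Gfr 1 * U ^ 2 * ((4 : ℝ) ^ n) ^ 0 else if (4 : ℕ) = 2 then R.Gfr 2 * U ^ 2 * ((4 : ℝ) ^ n) ^ 1 else if (4 : ℕ) = 3 then R.Gfr 3 / 3 * U ^ 2 * ((4 : ℝ) ^ n) ^ 2 else if (4 : ℕ) = 4 then R.Gfr 4 / 15 * U ^ 2 * ((4 : ℝ) ^ n) ^ 3 else 2 ^ 5 * (Real.pi ^ 8 / 4 * 2 ^ 4 * (2 : ℝ) ^ 32) * (curveExtC X G.S 1 + curveExtC X Q.S' 1 * |U|) / 63 * U ^ 2 * ((4 : ℝ) ^ n) ^ 4) + 2 * klZspLaw z U (n + 1) 4 := by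
    rw [if_neg (by norm_num), if_neg (by norm_num), if_neg (by norm_num), if_pos rfl]; exact add_nonneg (by positivity) (hzl 4)
  have hM5' : 0 ≤ (if (5 : ℕ) = 1 then 4 / 3 * R.Gfr 1 * U ^ 2 * ((4 : ℝ) ^ n) ^ 0 else if (5 : ℕ) = 2 then R.Gfr 2 * U ^ 2 * ((4 : ℝ) ^ n) ^ 1 else if (5 : ℕ) = 3 then R.Gfr 3 / 3 * U ^ 2 * ((4 : ℝ) ^ n) ^ 2 else if (5 : ℕ) = 4 then R.Gfr 4 / 15 * U ^ 2 * ((4 : ℝ) ^ n) ^ 3 else 2 ^ 5 * (Real.pi ^ 8 / 4 * 2 ^ 4 * (2 : ℝ) ^ 32) * (curveExtC X G.S 1 + curveExtC X Q.S' 1 * |U|) / 63 * U ^ 2 * ((4 : ℝ) ^ n) ^ 4) + 2 * klZspLaw z U (n + 1) 5 := by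
    rw [if_neg (by norm_num), if_neg (by norm_num), if_neg (by norm_num), if_neg (by norm_num)]
    exact add_nonneg (mul_nonneg (mul_nonneg (div_nonneg (mul_nonneg (by positivity) hW) (by norm_num)) (sq_nonneg U)) (by positivity)) (hzl 5)
  have hlaw1 : (if (1 : ℕ) = 1 then 4 / 3 * R.Gfr 1 * U ^ 2 * ((4 : ℝ) ^ n) ^ 0 else if (1 : ℕ) = 2 then R.Gfr 2 * U ^ 2 * ((4 : ℝ) ^ n) ^ 1 else if (1 : ℕ) = 3 then R.Gfr 3 / 3 * U ^ 2 * ((4 : ℝ) ^ n) ^ 2 else if (1 : ℕ) = 4 then R.Gfr 4 / 15 * U ^ 2 * ((4 : ℝ) ^ n) ^ 3 else 2 ^ 5 * (Real.pi ^ 8 / 4 * 2 ^ 4 * (2 : ℝ) ^ 32) * (curveExtC X G.S 1 + curveExtC X Q.S' 1 * |U|) / 63 * U ^ 2 * ((4 : ℝ) ^ n) ^ 4) + 2 * klZspLaw z U (n + 1) 1 ≤ m 1 * U ^ 2 * ((4 : ℝ) ^ n) ^ 0 := by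
    rw [if_pos rfl, two_mul_klZspLaw, show (1 : ℕ) - 1 = 0 from rfl, pow_succ (4 : ℝ) n]
    calc _ = (4 / 3 * R.Gfr 1 + 2 * z 1) * (U ^ 2 * ((4 : ℝ) ^ n) ^ 0) := by ring
      _ ≤ m 1 * (U ^ 2 * ((4 : ℝ) ^ n) ^ 0) := mul_le_mul_of_nonneg_right hl1 (hw 0)
      _ = m 1 * U ^ 2 * ((4 : ℝ) ^ n) ^ 0 := by ring
  have hlaw2 : (if (2 : ℕ) = 1 then 4 / 3 * R.Gfr 1 * U ^ 2 * ((4 : ℝ) ^ n) ^ 0 else if (2 : ℕ) = 2 then R.Gfr 2 * U ^ 2 * ((4 : ℝ) ^ n) ^ 1 else if (2 : ℕ) = 3 then R.Gfr 3 / 3 * U ^ 2 * ((4 : ℝ) ^ n) ^ 2 else if (2 : ℕ) = 4 then R.Gfr 4 / 15 * U ^ 2 * ((4 : ℝ) ^ n) ^ 3 else 2 ^ 5 * (Real.pi ^ 8 / 4 * 2 ^ 4 * (2 : ℝ) ^ 32) * (curveExtC X G.S 1 + curveExtC X Q.S' 1 * |U|) / 63 * U ^ 2 * ((4 : ℝ)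 ^ n) ^ 4) + 2 * klZspLaw z U (n + 1) 2 ≤ m 2 * U ^ 2 * ((4 : ℝ) ^ n) ^ 1 := by
    rw [if_neg (by norm_num), if_pos rfl, two_mul_klZspLaw, show (2 : ℕ) - 1 = 1 from rfl, pow_succ (4 : ℝ) n]
    calc _ = (R.Gfr 2 + 8 * z 2) * (U ^ 2 * ((4 : ℝ) ^ n) ^ 1) := by ring
      _ ≤ m 2 * (U ^ 2 * ((4 : ℝ) ^ n) ^ 1) := mul_le_mul_of_nonneg_right hl2 (hw 1)
      _ = m 2 * U ^ 2 * ((4 : ℝ) ^ n) ^ 1 := by ring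
  have hlaw3 : (if (3 : ℕ) = 1 then 4 / 3 * R.Gfr 1 * U ^ 2 * ((4 : ℝ) ^ n) ^ 0 else if (3 : ℕ) = 2 then R.Gfr 2 * U ^ 2 * ((4 : ℝ) ^ n) ^ 1 else if (3 : ℕ) = 3 then R.Gfr 3 / 3 * U ^ 2 * ((4 : ℝ) ^ n) ^ 2 else if (3 : ℕ) = 4 then R.Gfr 4 / 15 * U ^ 2 * ((4 : ℝ) ^ n) ^ 3 else 2 ^ 5 * (Real.pi ^ 8 / 4 * 2 ^ 4 * (2 : ℝ) ^ 32) * (curveExtC X G.S 1 + curveExtC X Q.S' 1 * |U|) / 63 * U ^ 2 * ((4 : ℝ) ^ n) ^ 4) + 2 * klZspLaw z U (n + 1) 3 ≤ m 3 * U ^ 2 * ((4 : ℝ) ^ n) ^ 2 := by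
    rw [if_neg (by norm_num), if_neg (by norm_num), if_pos rfl, two_mul_klZspLaw, show (3 : ℕ) - 1 = 2 from rfl, pow_succ (4 : ℝ) n]
    calc _ = (R.Gfr 3 / 3 + 32 * z 3) * (U ^ 2 * ((4 : ℝ) ^ n) ^ 2) := by ring
      _ ≤ m 3 * (U ^ 2 * ((4 : ℝ) ^ n) ^ 2) := mul_le_mul_of_nonneg_right hl3 (hw 2)
      _ = m 3 * U ^ 2 * ((4 : ℝ) ^ n) ^ 2 := by ring
  have hlaw4 : (if (4 : ℕ) = 1 then 4 / 3 * R.Gfr 1 * U ^ 2 * ((4 : ℝ) ^ n) ^ 0 else if (4 : ℕ) = 2 then R.Gfr 2 * U ^ 2 * ((4 : ℝ) ^ n) ^ 1 else if (4 : ℕ) = 3 then R.Gfr 3 / 3 * U ^ 2 * ((4 : ℝ) ^ n) ^ 2 else if (4 : ℕ) = 4 then R.Gfr 4 / 15 * U ^ 2 * ((4 : ℝ) ^ n) ^ 3 else 2 ^ 5 * (Real.pi ^ 8 / 4 * 2 ^ 4 * (2 : ℝ) ^ 32) * (curveExtC X G.S 1 + curveExtC X Q.S' 1 * |U|) / 63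 * U ^ 2 * ((4 : ℝ) ^ n) ^ 4) + 2 * klZspLaw z U (n + 1) 4 ≤ m 4 * U ^ 2 * ((4 : ℝ) ^ n) ^ 3 := by
    rw [if_neg (by norm_num), if_neg (by norm_num), if_neg (by norm_num), if_pos rfl, two_mul_klZspLaw, show (4 : ℕ) - 1 = 3 from rfl, pow_succ (4 : ℝ) n]
    calc _ = (R.Gfr 4 / 15 + 128 * z 4) * (U ^ 2 * ((4 : ℝ) ^ n) ^ 3) := by ring
      _ ≤ m 4 * (U ^ 2 * ((4 : ℝ) ^ n) ^ 3) := mul_le_mul_of_nonneg_right hl4 (hw 3)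
      _ = m 4 * U ^ 2 * ((4 : ℝ) ^ n) ^ 3 := by ring
  have hlaw5 : (if (5 : ℕ) = 1 then 4 / 3 * R.Gfr 1 * U ^ 2 * ((4 : ℝ) ^ n) ^ 0 else if (5 : ℕ) = 2 then R.Gfr 2 * U ^ 2 * ((4 : ℝ) ^ n) ^ 1 else if (5 : ℕ) = 3 then R.Gfr 3 / 3 * U ^ 2 * ((4 : ℝ) ^ n) ^ 2 else if (5 : ℕ) = 4 then R.Gfr 4 / 15 * U ^ 2 * ((4 : ℝ) ^ n) ^ 3 else 2 ^ 5 * (Real.pi ^ 8 / 4 * 2 ^ 4 * (2 : ℝ) ^ 32) * (curveExtC X G.S 1 + curveExtC X Q.S' 1 * |U|) / 63 * U ^ 2 * ((4 : ℝ) ^ n) ^ 4) + 2 * klZspLaw z U (n + 1) 5 ≤ m 5 * U ^ 2 * ((4 : ℝ) ^ n) ^ 4 := by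
    rw [if_neg (by norm_num), if_neg (by norm_num), if_neg (by norm_num), if_neg (by norm_num), two_mul_klZspLaw, show (5 : ℕ) - 1 = 4 from rfl, pow_succ (4 : ℝ) n]
    calc _ = (2 ^ 5 * (Real.pi ^ 8 / 4 * 2 ^ 4 * (2 : ℝ) ^ 32) * (curveExtC X G.S 1 + curveExtC X Q.S' 1 * |U|) / 63 + 512 * z 5) * (U ^ 2 * ((4 : ℝ) ^ n) ^ 4) := by ring
      _ ≤ m 5 * (U ^ 2 * ((4 : ℝ) ^ n) ^ 4) := mul_le_mul_of_nonneg_right hl5 (hw 4)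
      _ = m 5 * U ^ 2 * ((4 : ℝ) ^ n) ^ 4 := by ring
  exact (transport_rows_fit hR hU hU1 n hM1' hM2' hM3' hM4' hM5' hm hlaw1 hlaw2 hlaw3 hlaw4 hlaw5
    (D := fun k => |iteratedDeriv k (fun θ : ℝ =>
        (fun q : Momentum => (symInterp L (klLocSelfEnergyRe L M β U μ (klFlowFrameU L M β U μ (n + 1)) (n + 1))).eval (WithLp.ofLp q) + (klFlowPiece L M β U μ n).eval (WithLp.ofLp q))
            (WithLp.toLp 2 (klFermiPoint μ (fsub (klFlowFrameU L M β U μ n) (klFlowPiece L M β U μ n)) θ)) -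
          (fun q : Momentum => (symInterp L (klLocSelfEnergyRe L M β U μ (klFlowFrameU L M β U μ (n + 1)) (n + 1))).eval (WithLp.ofLp q) + (klFlowPiece L M β U μ n).eval (WithLp.ofLp q))
            (WithLp.toLp 2 (klFermiPoint μ (klFlowFrameU L M β U μ n) θ))) θ|) r0 r1 r2 r3 r4 k hk).trans (curveJetBar_zero_mono_snd_at (heT k hk))

end AtSucc

end General

end Summit.HubbardSuperconductivity.HubbardSuperconductivity.Theorems.EngineV8

end
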